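import Summits.RiemannHypothesis.RiemannHypothesis.Theorems.OddSectorOddOneSignedWindowsSmallWindowFold
import Summits.RiemannHypothesis.RiemannHypothesis.Theorems.OddSectorOddOneSignedWindowsExistence
import HarnessLib

/-!
# Good windows below the first prime, II: one-signed odd ground states of the FULL Weil form for
# `2a ≤ log 2` (helper for crux `OddSector.OddOneSignedWindows`, item stmt-RiemannHypothesis-17778; RH-free)

The crux `OddOneSignedWindows` asks for windows `a`, BEYOND EVERY HEIGHT, carrying an odd-sector
ground state `u` of Weil's windowed quadratic form (`IsWeilOddGroundState a u`) that is real and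
`≥ 0` a.e. on the right half-window `(0, a)` ("good windows"). This file settles the small-scale
half of the picture unconditionally: **every window with `0 < a` and `2a ≤ log 2` is good**
(`exists_oneSigned_isWeilOddGroundState_of_two_mul_le_log_two`, and in the crux's inline shape
`goodWindow_of_two_mul_le_log_two`). So the matrix of the crux is inhabited (on a bounded set of
windows), and the whole difficulty of the crux is located where the prime atoms `log n < 2a`
enter the window — the prime REFLECTIONS being the only non-positivity-preserving piece of the
odd-sector form (route text, 2001 §7; the first failure of one-signedness lies in
`[½ log 2, log 2)`, 2001 Cor. 10.4).

## Proof (antisymmetric Beurling–Deny folding, as for `OddArchAnchor`; the pole-form and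
## prime-part lemmas are in `Theorems/OddSectorOddOneSignedWindowsSmallWindowFold.lean`)

By the Markov decomposition of the form on the window
(`weilQuadratic_re_eq_weilPoleForm_add_weilDirichletEnergy_sub`),
`Re Q(g) = P(g) + 𝓔_a(g) − M_a‖g‖₂²` with `P(g) = 2|∫ g cosh(t/2)|² − 2|∫ g sinh(t/2)|²` the pole
form, `𝓔_a` the pure-jump Dirichlet form (prime jumps at the lengths `log n < 2a` plus the
archimedean jump density) and `M_a` a constant. For `2a ≤ log 2` the prime index set carries no
mass (`Λ(0) = Λ(1) = 0`; `sum_weilPrimeIndex_eq_zero_of_two_mul_le_log_two`), so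
`Re Q(g) = P(g) + ∫₀^∞ ρ D_t(g) dt − M_a‖g‖₂²`. For ODD `g` the `cosh`-moment vanishes and
`P(g) = −2|∫ g sinh(t/2)|²` (`weilPoleForm_eq_of_odd`). Take an odd ground state `u` with its odd
minimising sequence `gₙ → u` (`exists_isWeilOddGroundState`), and the smooth antisymmetric folds
`hₙ` of `gₙ` (`OddArchAnchor.exists_smooth_fold`, `|hₙ − sign·|gₙ|| ≤ 2ηₙ → 0`). The archimedean
energy does not increase under folding (`setIntegral_weilArchDensity_mul_weilIncrement_fold_le`,
the folded-kernel inequality), and neither does the pole form up to `O(ηₙ)`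
(`weilPoleForm_fold_le`: `|∫ g sinh(t/2)| ≤ ∫ |g| |sinh(t/2)| ≤ |∫ h sinh(t/2)| + 4aηe^a`). Hence the
renormalised folds `fₙ = hₙ/‖hₙ‖₂` are odd window tests with `Re Q(fₙ) → ε_od(a)` converging in
`L²` to `v = sign·|u|`, which is therefore an odd ground state, real and `≥ 0` on `(0, ∞)`.
No uniqueness is claimed.

## References

* E. Bombieri, Rend. Mat. Acc. Lincei (9) 11 (2000), Thm 2 and §4.
* R. Bañuelos, T. Kulczycki, J. Funct. Anal. 211 (2004), Thm 4.3 (antisymmetric folding).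
* 2001 programme, route `odd-sector-eigenfunction-sign`, results §7 and Cor. 10.4 (internal).
-/

noncomputable section

set_option linter.dupNamespace false

open MeasureTheory Set Filter
open scoped Topology ENNReal ArithmeticFunction.vonMangoldt

namespace Summit.RiemannHypothesis.RiemannHypothesis.Theorems.OddSector

open Literature.NumberTheory.LFunctions
open Summit.RiemannHypothesis.RiemannHypothesis.Theorems.WeilGroundStateMarkovPart
open Summit.RiemannHypothesis.RiemannHypothesis.Theorems.OddArchAnchor
open Summit.RiemannHypothesis.RiemannHypothesis.Theorems.WeilWindowFlowWindowLipschitz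
open Literature.NumberTheory.LFunctions.ConnesVanSuijlekom (tendsto_integral_norm_sq)

/-! ### Good windows below the first prime -/

/-- **Every window below the first prime is good.** For `0 < a` with `2a ≤ log 2` there is an
odd-sector ground state `v` of Weil's windowed form at `a` (`IsWeilOddGroundState a v`) which is
REAL everywhere and `≥ 0` on `(0, ∞)`: the antisymmetric fold `v = sign·|u|` of any odd ground
state `u`. (Below the first prime the windowed form is the attractive rank-one pole term plus the
archimedean pure-jump form minus a constant, and both fold.) [folklore] -/
theorem exists_oneSigned_isWeilOddGroundState_of_two_mul_le_log_two :
    ∀ (a : ℝ), 0 < a → 2 * a ≤ Real.log 2 →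
      ∃ v : ℝ → ℂ, IsWeilOddGroundState a v ∧ (∀ t, (v t).im = 0) ∧ ∀ t, 0 < t → 0 ≤ (v t).re := by
  intro a ha h2
  -- an odd ground state and its minimising sequence
  obtain ⟨u, hu⟩ := exists_isWeilOddGroundState ha
  obtain ⟨hu2, g, hg, hQ, hlim⟩ := (isWeilOddGroundState_iff_tendsto a u).1 hu
  set ε : ℝ := weilOddGroundEnergy a with hε
  set M : ℝ := weilMarkovConstant a with hM
  set E : (ℝ → ℂ) → ℝ := fun f ↦ ∫ t in Ioi (0 : ℝ), weilArchDensity t * weilIncrement f t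
    with hEdef
  have hQE : ∀ f : ℝ → ℂ, IsWeilTest f → tsupport f ⊆ Icc (-a) a → ∫ x, ‖f x‖ ^ 2 = (1 : ℝ) →
      (weilQuadratic f).re = weilPoleForm f + E f - M := fun f hf hfs hn ↦ by
    rw [re_weilQuadratic_eq_of_two_mul_le_log_two h2 hf hfs, hn, mul_one]
  have hgm : ∀ n, MemLp (g n) 2 := fun n ↦ (hg n).1.memLp_two
  have hun : ∫ x, ‖u x‖ ^ 2 = 1 := hu.integral_norm_sq
  -- (2) the smooth folds
  set η : ℕ → ℝ := fun n ↦ 1 / ((n : ℝ) + 1) with hη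
  have hηpos : ∀ n, 0 < η n := fun n ↦ by positivity
  have hη0 : Tendsto η atTop (𝓝 0) := tendsto_one_div_add_atTop_nhds_zero_nat
  have hfold := fun n ↦ exists_smooth_fold (hg n).1 (hg n).2.2.1 (hηpos n)
  choose h hh hho hhs hhd hhn hhc using hfold
  have hhsupp : ∀ n, tsupport (h n) ⊆ Icc (-a) a := fun n ↦ (hhs n).trans (hg n).2.1
  have hhm : ∀ n, MemLp (h n) 2 := fun n ↦ (hh n).memLp_two
  have hEh : ∀ n, E (h n) ≤ E (g n) := fun n ↦
    setIntegral_weilArchDensity_mul_weilIncrement_fold_le (hg n).1 (hh n) (hg n).2.2.1 (hho n)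
      (hhd n) (hhn n)
  -- the pole-form error
  set err : ℕ → ℝ := fun n ↦ 4 * (Real.exp a * Real.sqrt (2 * a)) * (2 * η n * (Real.exp a * (2 * a))) +
    2 * (2 * η n * (Real.exp a * (2 * a))) ^ 2 with herr
  have hPh : ∀ n, weilPoleForm (h n) ≤ weilPoleForm (g n) + err n := fun n ↦
    weilPoleForm_fold_le ha (hηpos n).le (hg n).1 (hh n) (hg n).2.1 (hhsupp n) (hg n).2.2.1 (hho n)
      (hg n).2.2.2 (hhn n) (hhc n)
  have herr0 : Tendsto err atTop (𝓝 0) := by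
    have h1 : Tendsto (fun n ↦ 2 * η n * (Real.exp a * (2 * a))) atTop (𝓝 (2 * 0 * (Real.exp a * (2 * a)))) :=
      (hη0.const_mul 2).mul_const _
    have h2 := ((h1.const_mul (4 * (Real.exp a * Real.sqrt (2 * a)))).add ((h1.pow 2).const_mul 2))
    simpa [herr] using h2
  -- the limit: the antisymmetric fold of `u`
  set v : ℝ → ℂ := fun x ↦ (((Real.sign x * ‖u x‖ : ℝ)) : ℂ) with hv
  have hvm : MemLp v 2 := memLp_signFold hu2
  have hvn : ∫ x, ‖v x‖ ^ 2 = 1 := by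
    rw [← hun]
    exact integral_norm_sq_signFold u
  -- (3) `h n → v` in `L²`
  have hL2 : Tendsto (fun n ↦ ∫ x, ‖h n x - v x‖ ^ 2) atTop (𝓝 0) := by
    have hb : ∀ n, ∫ x, ‖h n x - v x‖ ^ 2 ≤
        2 * ((2 * η n) ^ 2 * (2 * a)) + 2 * ∫ x, ‖g n x - u x‖ ^ 2 := by
      intro n
      set F : ℝ → ℂ := fun x ↦ (((Real.sign x * ‖g n x‖ : ℝ)) : ℂ) with hF
      have hFm : MemLp F 2 := memLp_signFold (hgm n)
      have h1 : ∫ x, ‖h n x - F x‖ ^ 2 ≤ (2 * η n) ^ 2 * (2 * a) := by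
        refine integral_norm_sq_le_of_window ha.le (fun x ↦ hhc n x) (fun x hx ↦ ?_)
        have hx1 : h n x = 0 := image_eq_zero_of_notMem_tsupport fun h' ↦ hx (hhsupp n h')
        have hx2 : g n x = 0 := image_eq_zero_of_notMem_tsupport fun h' ↦ hx ((hg n).2.1 h')
        simp only [hF, hx1, hx2, norm_zero, mul_zero, Complex.ofReal_zero, sub_zero]
      have h2 : ∫ x, ‖F x - v x‖ ^ 2 ≤ ∫ x, ‖g n x - u x‖ ^ 2 := by
        have hm : MemLp (fun x ↦ g n x - u x) 2 := (hgm n).sub hu2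
        refine integral_mono_of_nonneg (Eventually.of_forall fun x ↦ by positivity)
          ((memLp_two_iff_integrable_sq_norm hm.1).1 hm) (Eventually.of_forall fun x ↦ ?_)
        exact pow_le_pow_left₀ (norm_nonneg _) (norm_signFold_sub_le (g n) u x) 2
      have h3 := integral_norm_sq_add_le ((hhm n).sub hFm) (hFm.sub hvm)
      have e3 : (fun x ↦ ‖(h n - F) x + (F - v) x‖ ^ 2) = fun x ↦ ‖h n x - v x‖ ^ 2 := by
        funext x
        simp only [Pi.sub_apply, sub_add_sub_cancel]
      rw [e3] at h3
      simp only [Pi.sub_apply] at h3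
      linarith
    refine squeeze_zero (fun n ↦ integral_nonneg fun _ ↦ by positivity) hb ?_
    have h4 : Tendsto (fun n ↦ 2 * ((2 * η n) ^ 2 * (2 * a)) + 2 * ∫ x, ‖g n x - u x‖ ^ 2)
        atTop (𝓝 (2 * ((2 * 0) ^ 2 * (2 * a)) + 2 * 0)) :=
      ((((hη0.const_mul 2).pow 2).mul_const _).const_mul 2).add (hlim.const_mul 2)
    simpa using h4
  -- (4) the norms of the folds tend to `1`; shift the index so that they are `≥ 1/2`
  have hN : Tendsto (fun n ↦ ∫ x, ‖h n x‖ ^ 2) atTop (𝓝 1) := by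
    have := tendsto_integral_norm_sq hvm hhm hL2
    rwa [hvn] at this
  obtain ⟨n₀, hn₀⟩ : ∃ n₀, ∀ n ≥ n₀, (1 / 2 : ℝ) ≤ ∫ x, ‖h n x‖ ^ 2 :=
    eventually_atTop.1 (hN.eventually (Ici_mem_nhds (by norm_num : (1 / 2 : ℝ) < 1)))
  set N : ℕ → ℝ := fun n ↦ ∫ x, ‖h (n + n₀) x‖ ^ 2 with hNdef
  have hNpos : ∀ n, 0 < N n := fun n ↦
    lt_of_lt_of_le (by norm_num) (hn₀ (n + n₀) (Nat.le_add_left _ _))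
  have hNlim : Tendsto N atTop (𝓝 1) := hN.comp (tendsto_add_atTop_nat n₀)
  -- (5) the renormalised sequence
  set c : ℕ → ℝ := fun n ↦ (Real.sqrt (N n))⁻¹ with hcdef
  have hcpos : ∀ n, 0 < c n := fun n ↦ inv_pos.2 (Real.sqrt_pos.2 (hNpos n))
  have hc2 : ∀ n, ‖(c n : ℂ)‖ ^ 2 = (N n)⁻¹ := fun n ↦ by
    rw [Complex.norm_real, Real.norm_of_nonneg (hcpos n).le, hcdef, inv_pow,
      Real.sq_sqrt (hNpos n).le]
  have hc1 : Tendsto c atTop (𝓝 1) := by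
    have h1 := (hNlim.sqrt).inv₀ (by simp)
    simpa using h1
  set f : ℕ → ℝ → ℂ := fun n x ↦ (c n : ℂ) * h (n + n₀) x with hfdef
  have hft : ∀ n, IsWeilTest (f n) := fun n ↦ (hh _).const_mul _
  have hfs : ∀ n, tsupport (f n) ⊆ Icc (-a) a := fun n ↦
    tsupport_mul_subset_right.trans (hhsupp _)
  have hfo : ∀ n t, f n (-t) = -f n t := fun n t ↦ by simp only [hfdef, hho, mul_neg]
  have hfn : ∀ n, ∫ x, ‖f n x‖ ^ 2 = 1 := by
    intro n
    have e : (fun x ↦ ‖f n x‖ ^ 2) = fun x ↦ ‖(c n : ℂ)‖ ^ 2 * ‖h (n + n₀) x‖ ^ 2 := by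
      funext x
      simp only [hfdef, norm_mul, mul_pow]
    rw [e, integral_const_mul, hc2]
    exact inv_mul_cancel₀ (hNpos n).ne'
  -- `Re Q(f n) → ε`
  have hQf_le : ∀ n, (weilQuadratic (f n)).re ≤
      (N n)⁻¹ * ((weilQuadratic (g (n + n₀))).re + M + err (n + n₀)) - M := fun n ↦ by
    rw [hQE (f n) (hft n) (hfs n) (hfn n)]
    have e1 : E (f n) = (N n)⁻¹ * E (h (n + n₀)) := by
      simp only [hEdef, hfdef]
      rw [archEnergy_const_mul, hc2]
    have e2 : weilPoleForm (f n) = (N n)⁻¹ * weilPoleForm (h (n + n₀)) := by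
      simp only [hfdef]
      rw [weilPoleForm_const_mul, hc2]
    have e3 : (weilQuadratic (g (n + n₀))).re + M =
        weilPoleForm (g (n + n₀)) + E (g (n + n₀)) := by
      rw [hQE (g (n + n₀)) (hg _).1 (hg _).2.1 (hg _).2.2.2]
      ring
    rw [e1, e2, e3]
    have hsum : weilPoleForm (h (n + n₀)) + E (h (n + n₀)) ≤
        weilPoleForm (g (n + n₀)) + E (g (n + n₀)) + err (n + n₀) := by
      linarith [hPh (n + n₀), hEh (n + n₀)]
    have := mul_le_mul_of_nonneg_left hsum (inv_nonneg.2 (hNpos n).le)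
    nlinarith [this]
  have hQf_ge : ∀ n, ε ≤ (weilQuadratic (f n)).re := fun n ↦
    weilOddGroundEnergy_le (hft n) (hfs n) (hfo n) (hfn n)
  have hup : Tendsto (fun n ↦ (N n)⁻¹ * ((weilQuadratic (g (n + n₀))).re + M + err (n + n₀)) - M)
      atTop (𝓝 ε) := by
    have h1 : Tendsto (fun n ↦ (N n)⁻¹) atTop (𝓝 1) := by simpa using hNlim.inv₀ one_ne_zero
    have h3 : Tendsto (fun n ↦ (weilQuadratic (g (n + n₀))).re + M + err (n + n₀)) atTop
        (𝓝 (ε + M + 0)) :=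
      ((hQ.comp (tendsto_add_atTop_nat n₀)).add_const M).add (herr0.comp (tendsto_add_atTop_nat n₀))
    have h4 := (h1.mul h3).sub_const M
    have e : (1 : ℝ) * (ε + M + 0) - M = ε := by ring
    rw [e] at h4
    exact h4
  have hQf : Tendsto (fun n ↦ (weilQuadratic (f n)).re) atTop (𝓝 ε) :=
    tendsto_of_tendsto_of_tendsto_of_le_of_le tendsto_const_nhds hup hQf_ge hQf_le
  -- `f n → v` in `L²`
  have hfL2 : Tendsto (fun n ↦ ∫ x, ‖f n x - v x‖ ^ 2) atTop (𝓝 0) := by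
    have hb : ∀ n, ∫ x, ‖f n x - v x‖ ^ 2 ≤
        2 * ((c n - 1) ^ 2 * N n) + 2 * ∫ x, ‖h (n + n₀) x - v x‖ ^ 2 := by
      intro n
      have hA : MemLp (fun x ↦ (((c n - 1 : ℝ)) : ℂ) * h (n + n₀) x) 2 := (hhm _).const_mul _
      have hB : MemLp (fun x ↦ h (n + n₀) x - v x) 2 := (hhm _).sub hvm
      have h3 := integral_norm_sq_add_le hA hB
      have e3 : (fun x ↦ ‖(((c n - 1 : ℝ)) : ℂ) * h (n + n₀) x + (h (n + n₀) x - v x)‖ ^ 2) =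
          fun x ↦ ‖f n x - v x‖ ^ 2 := by
        funext x
        simp only [hfdef]
        congr 2
        push_cast
        ring
      have e4 : ∫ x, ‖(((c n - 1 : ℝ)) : ℂ) * h (n + n₀) x‖ ^ 2 = (c n - 1) ^ 2 * N n := by
        have : (fun x ↦ ‖(((c n - 1 : ℝ)) : ℂ) * h (n + n₀) x‖ ^ 2) =
            fun x ↦ (c n - 1) ^ 2 * ‖h (n + n₀) x‖ ^ 2 := by
          funext x
          rw [norm_mul, mul_pow, Complex.norm_real, Real.norm_eq_abs, sq_abs]
        rw [this, integral_const_mul]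
      rw [e3, e4] at h3
      exact h3
    refine squeeze_zero (fun n ↦ integral_nonneg fun _ ↦ by positivity) hb ?_
    have h4 : Tendsto (fun n ↦ 2 * ((c n - 1) ^ 2 * N n) + 2 * ∫ x, ‖h (n + n₀) x - v x‖ ^ 2)
        atTop (𝓝 (2 * ((1 - 1) ^ 2 * 1) + 2 * 0)) :=
      ((((hc1.sub_const 1).pow 2).mul hNlim).const_mul 2).add
        ((hL2.comp (tendsto_add_atTop_nat n₀)).const_mul 2)
    simpa using h4
  -- assemble
  refine ⟨v, IsWeilOddGroundState.of_tendsto hvm (fun n ↦ ⟨hft n, hfs n, hfo n, hfn n⟩) hQf hfL2,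
    fun t ↦ by simp only [hv, Complex.ofReal_im], fun t ht ↦ ?_⟩
  simp only [hv, Complex.ofReal_re, Real.sign_of_pos ht, one_mul]
  exact norm_nonneg _

/-- **Good windows below the first prime, in the shape of the crux.** For `0 < a`, `2a ≤ log 2`,
the window `a` carries an odd-sector ground state which is real and `≥ 0` a.e. on `(0, a)` — the
matrix of `OddSector.OddOneSignedWindows` (and the hypothesis of `OddSector.OddBartaFloor`) at the
window `a`, in the vocabulary of `IsWeilOddGroundState`. [folklore] -/
theorem exists_isWeilOddGroundState_oneSigned_of_two_mul_le_log_two {a : ℝ} (ha : 0 < a)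
    (h2 : 2 * a ≤ Real.log 2) :
    ∃ u : ℝ → ℂ, IsWeilOddGroundState a u ∧
      (∀ᵐ t : ℝ, t ∈ Ioo 0 a → (u t).im = 0 ∧ 0 ≤ (u t).re) := by
  obtain ⟨v, hv, him, hre⟩ := exists_oneSigned_isWeilOddGroundState_of_two_mul_le_log_two a ha h2
  exact ⟨v, hv, Eventually.of_forall fun t ht ↦ ⟨him t, hre t ht.1⟩⟩

/-- **Good windows below the first prime, inline form.** For `0 < a`, `2a ≤ log 2`, the window
`a` satisfies LITERALLY the matrix of the route statement `OddSector.OddOneSignedWindows`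
(Mathlib-primitive rev-1 form: `u ∈ L²`, an `L²`-normalised minimising sequence of smooth odd
window tests converging to `u` in `L²`, and the sign clause on `(0, a)`). In particular the set of
good windows contains `(0, ½ log 2]`; the crux asks for it to be unbounded. [folklore] -/
theorem goodWindow_of_two_mul_le_log_two {a : ℝ} (ha : 0 < a) (h2 : 2 * a ≤ Real.log 2) :
    ∃ u : ℝ → ℂ, (MeasureTheory.MemLp u 2 ∧ ∃ g : ℕ → ℝ → ℂ,
      (∀ n, (ContDiff ℝ ((⊤ : ℕ∞) : WithTop ℕ∞) (g n) ∧ HasCompactSupport (g n)) ∧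
        tsupport (g n) ⊆ Set.Icc (-a) a ∧ (∀ t, g n (-t) = -g n t) ∧
        ∫ t, ‖g n t‖ ^ 2 = (1 : ℝ)) ∧
      (∀ h : ℝ → ℂ, (ContDiff ℝ ((⊤ : ℕ∞) : WithTop ℕ∞) h ∧ HasCompactSupport h) →
        tsupport h ⊆ Set.Icc (-a) a → (∀ t, h (-t) = -h t) → ∫ t, ‖h t‖ ^ 2 = (1 : ℝ) →
        ∀ δ : ℝ, 0 < δ → ∀ᶠ n in Filter.atTop,
          (weilQuadratic (g n)).re ≤ (weilQuadratic h).re + δ) ∧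
      Filter.Tendsto (fun n => ∫ t, ‖g n t - u t‖ ^ 2) Filter.atTop (nhds 0)) ∧
      (∀ᵐ t : ℝ, t ∈ Set.Ioo 0 a → (u t).im = 0 ∧ 0 ≤ (u t).re) :=
  exists_isWeilOddGroundState_oneSigned_of_two_mul_le_log_two ha h2

end Summit.RiemannHypothesis.RiemannHypothesis.Theorems.OddSector

end
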